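import Mathlib
import Summits.ValiantsHypothesis.ValiantsHypothesis.Theorems.FeketeSOSCharPSparseSOSQRPerfectBarrier

/-!
# Crux `FeketeSOS.CharPSparseSOS` (stmt-ValiantsHypothesis-14989), line `Sketch-ideator5` — stub
`stub_windowCounting`

Window counting for a near-perfect Paley sum-configuration.  For an odd prime `p` and a finite set
`Q` of naturals put `r_Q(n) = #{(a,b) ∈ Q × Q : a < b, a + b ≡ n (mod p)}`,
`1_QR(n) = [n ≠ 0 ∧ (n|p) = 1]` and `Err = {n < p : r_Q(n) ≠ 1_QR(n)}`.  Then

* (coverage) `p − 1 − 2 #Err ≤ #Q (#Q − 1)`;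
* (first moment) `2(p − 1) − 4 #Err − #Q² ≤ Σ_{x ∈ Q} Σ_{a ∈ Q} χ_p(x + a)`.

Proof.  Let `R = {0 < n < p : χ_p(n) = 1}` (`2 #R = p − 1`, from `Σ_{n<p} χ_p(n) = 0`), `G ⊆ R` the
residues carrying exactly one pair, `P₂` the pairs `a < b` of `Q × Q`.  Then `#R ≤ #G + #Err`,
`#G ≤ Σ_n r_Q(n) = #P₂` and `2 #P₂ + #Q = #Q²`, which gives the coverage bound.  For the first moment,
`Σ_{x,a} χ(x+a) = Σ_{x} χ(2x) + 2 Σ_{P₂} χ(a+b)`, the diagonal is `≥ −#Q`, and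
`Σ_{P₂} χ(a+b) = Σ_n r_Q(n) χ(n) ≥ #G − (#P₂ − #G)`.
-/

-- `Summit.ValiantsHypothesis.ValiantsHypothesis.…` is the tree's mandated single-conjunct layout (Sub = Summit).
set_option linter.dupNamespace false

namespace Summit.ValiantsHypothesis.ValiantsHypothesis.Theorems.CharPSparseSOSTraceBias

open Finset
open Summit.ValiantsHypothesis.ValiantsHypothesis.Theorems.CharPSparseSOSTwoCusp (qrp_sum_product_split)

/-! ## Values of the Legendre symbol -/

/-- The Legendre symbol is at least `-1`. -/
theorem wc_neg_one_le_legendreSym (p : ℕ) [Fact p.Prime] (a : ℤ) : -1 ≤ legendreSym p a := by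
  rcases eq_or_ne (a : ZMod p) 0 with ha | ha
  · rw [(legendreSym.eq_zero_iff p a).mpr ha]
    norm_num
  · rcases legendreSym.eq_one_or_neg_one p ha with h | h <;> rw [h]
    norm_num

/-- The value pattern of the Legendre symbol on `[0, p)`:
`χ_p(m) = 2·[m ≠ 0 ∧ χ_p(m) = 1] − [m ≠ 0]`. -/
theorem wc_legendreSym_eq_indicator (p : ℕ) [Fact p.Prime] (m : ℕ) (hm : m < p) :
    legendreSym p m =
      2 * (if m ≠ 0 ∧ legendreSym p m = 1 then (1 : ℤ) else 0) - (if m ≠ 0 then (1 : ℤ) else 0) := by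
  -- adapted from `qrp_legendre_term` (QR-perfect barrier file)
  rcases Nat.eq_zero_or_pos m with rfl | hm0
  · simp [legendreSym.at_zero]
  · have hne : ((m : ℤ) : ZMod p) ≠ 0 := by
      rw [Int.cast_natCast, Ne, ZMod.natCast_eq_zero_iff]
      exact Nat.not_dvd_of_pos_of_lt hm0 hm
    rcases legendreSym.eq_one_or_neg_one p hne with h | h
    · rw [if_pos ⟨hm0.ne', h⟩, if_pos hm0.ne', h]
      norm_num
    · have hc : ¬ (m ≠ 0 ∧ legendreSym p m = 1) := fun h' => by rw [h] at h'; norm_num at h'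
      rw [if_neg hc, if_pos hm0.ne', h]
      norm_num

/-- `Σ_{m<p} χ_p(m) = 0` for an odd prime `p` (Mathlib's `quadraticChar_sum_zero` transported along
`Finset.range p ≃ ZMod p`). -/
theorem wc_sum_range_legendreSym (p : ℕ) [Fact p.Prime] (hp : p ≠ 2) :
    ∑ m ∈ range p, legendreSym p m = 0 := by
  -- adapted from `Literature.NumberTheory.LFunctions.sum_range_legendreSym`
  have h1 : ∑ m ∈ range p, legendreSym p m = ∑ i : Fin p, legendreSym p (i : ℕ) :=
    (Fin.sum_univ_eq_sum_range (fun m => legendreSym p m) p).symm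
  have hbij : Function.Bijective (fun i : Fin p => ((i : ℕ) : ZMod p)) := by
    rw [Fintype.bijective_iff_injective_and_card, ZMod.card, Fintype.card_fin]
    refine ⟨fun i j h => Fin.ext ?_, rfl⟩
    have h' := congrArg ZMod.val h
    simp only [ZMod.val_natCast, Nat.mod_eq_of_lt i.isLt, Nat.mod_eq_of_lt j.isLt] at h'
    exact h'
  rw [h1, Fintype.sum_bijective _ hbij (fun i => legendreSym p (i : ℕ))
    (fun a => quadraticChar (ZMod p) a) (fun i => by simp [legendreSym])]
  exact quadraticChar_sum_zero (by rwa [ZMod.ringChar_zmod_n])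

/-- Exactly half of the non-zero residues are quadratic residues: `2 #{0 < n < p : χ_p(n) = 1} = p − 1`. -/
theorem wc_two_card_qr (p : ℕ) [Fact p.Prime] (hp2 : p ≠ 2) :
    2 * (((range p).filter (fun n : ℕ => n ≠ 0 ∧ legendreSym p n = 1)).card : ℤ) = (p : ℤ) - 1 := by
  have hp : p.Prime := Fact.out
  have h1 : ∑ m ∈ range p, legendreSym p m =
      2 * ∑ m ∈ range p, (if m ≠ 0 ∧ legendreSym p m = 1 then (1 : ℤ) else 0) -
        ∑ m ∈ range p, (if m ≠ 0 then (1 : ℤ) else 0) := by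
    rw [mul_sum, ← sum_sub_distrib]
    exact sum_congr rfl fun m hm => wc_legendreSym_eq_indicator p m (mem_range.1 hm)
  rw [wc_sum_range_legendreSym p hp2, sum_boole, sum_boole, filter_ne', card_erase_of_mem
    (mem_range.2 hp.pos), card_range, Nat.cast_pred hp.pos] at h1
  linarith

/-! ## Counting restricted pair sums -/

/-- The fibres of `(a,b) ↦ (a+b) mod p` on the pairs `a < b` add up to all pairs. -/
theorem wc_sum_count (p : ℕ) (hp : 0 < p) (Q : Finset ℕ) :
    ∑ n ∈ range p, ((Q ×ˢ Q).filter
        (fun ab : ℕ × ℕ => ab.1 < ab.2 ∧ (ab.1 + ab.2) % p = n)).card =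
      ((Q ×ˢ Q).filter (fun ab : ℕ × ℕ => ab.1 < ab.2)).card := by
  rw [card_eq_sum_card_fiberwise (f := fun ab : ℕ × ℕ => (ab.1 + ab.2) % p) (t := range p)
    (fun ab _ => mem_coe.2 (mem_range.2 (Nat.mod_lt _ hp)))]
  refine sum_congr rfl fun n _ => ?_
  rw [filter_filter]

/-- Twice the number of pairs `a < b` plus the diagonal is `#Q²`. -/
theorem wc_two_card_pairs (Q : Finset ℕ) :
    2 * ((Q ×ˢ Q).filter (fun ab : ℕ × ℕ => ab.1 < ab.2)).card + Q.card = Q.card * Q.card := by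
  have h := qrp_sum_product_split Q (fun _ => (1 : ℕ))
  simp only [sum_const, smul_eq_mul, mul_one, card_product] at h
  omega

/-- The good residues (non-zero quadratic residues carrying exactly one pair) and the error set cover the
non-zero quadratic residues. -/
theorem wc_card_qr_le (p : ℕ) [Fact p.Prime] (r : ℕ → ℕ) :
    ((range p).filter (fun n : ℕ => n ≠ 0 ∧ legendreSym p n = 1)).card ≤
      ((range p).filter (fun n : ℕ => (n ≠ 0 ∧ legendreSym p n = 1) ∧ r n = 1)).card +
        ((range p).filter (fun n => r n ≠ (if n ≠ 0 ∧ legendreSym p n = 1 then 1 else 0))).card := by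
  have hsplit := card_filter_add_card_filter_not
    (s := (range p).filter (fun n : ℕ => n ≠ 0 ∧ legendreSym p n = 1)) (fun n => r n = 1)
  rw [filter_filter, filter_filter] at hsplit
  have hsub : (range p).filter (fun n : ℕ => (n ≠ 0 ∧ legendreSym p n = 1) ∧ ¬ r n = 1) ⊆
      (range p).filter (fun n => r n ≠ (if n ≠ 0 ∧ legendreSym p n = 1 then 1 else 0)) := by
    intro n hn
    simp only [mem_filter] at hn ⊢
    refine ⟨hn.1, ?_⟩
    rw [if_pos hn.2.1]
    exact hn.2.2
  have := card_le_card hsub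
  omega

/-- The number of good residues is at most the total pair count `Σ_n r(n)`. -/
theorem wc_card_good_le_sum (p : ℕ) [Fact p.Prime] (r : ℕ → ℕ) :
    ((range p).filter (fun n : ℕ => (n ≠ 0 ∧ legendreSym p n = 1) ∧ r n = 1)).card ≤
      ∑ n ∈ range p, r n := by
  calc ((range p).filter (fun n : ℕ => (n ≠ 0 ∧ legendreSym p n = 1) ∧ r n = 1)).card
      = ∑ n ∈ (range p).filter (fun n : ℕ => (n ≠ 0 ∧ legendreSym p n = 1) ∧ r n = 1), r n := by
        rw [card_eq_sum_ones]
        exact sum_congr rfl fun n hn => ((mem_filter.1 hn).2.2).symm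
    _ ≤ ∑ n ∈ range p, r n := sum_le_sum_of_subset (filter_subset _ _)

/-- First-moment lower bound: `Σ_n r(n) χ_p(n) ≥ 2 #G − Σ_n r(n)` with `G` the good residues
(on `G` the summand is `1`, elsewhere it is `≥ −r(n)`). -/
theorem wc_sum_mul_legendreSym_ge (p : ℕ) [Fact p.Prime] (r : ℕ → ℕ) :
    2 * (((range p).filter (fun n : ℕ => (n ≠ 0 ∧ legendreSym p n = 1) ∧ r n = 1)).card : ℤ) -
        ((∑ n ∈ range p, r n : ℕ) : ℤ) ≤ ∑ n ∈ range p, (r n : ℤ) * legendreSym p n := by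
  have h1 : ∑ n ∈ (range p).filter (fun n : ℕ => (n ≠ 0 ∧ legendreSym p n = 1) ∧ r n = 1),
      (r n : ℤ) * legendreSym p n =
        (((range p).filter (fun n : ℕ => (n ≠ 0 ∧ legendreSym p n = 1) ∧ r n = 1)).card : ℤ) := by
    rw [card_eq_sum_ones, Nat.cast_sum]
    refine sum_congr rfl fun n hn => ?_
    obtain ⟨-, ⟨-, hχ⟩, hr⟩ := mem_filter.1 hn
    rw [hχ, hr]
    norm_num
  have h2 : ∑ n ∈ (range p).filter (fun n : ℕ => (n ≠ 0 ∧ legendreSym p n = 1) ∧ r n = 1), r n =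
      ((range p).filter (fun n : ℕ => (n ≠ 0 ∧ legendreSym p n = 1) ∧ r n = 1)).card := by
    rw [card_eq_sum_ones]
    exact sum_congr rfl fun n hn => (mem_filter.1 hn).2.2
  have h3 : ∀ n ∈ (range p).filter (fun n : ℕ => ¬ ((n ≠ 0 ∧ legendreSym p n = 1) ∧ r n = 1)),
      -(r n : ℤ) ≤ (r n : ℤ) * legendreSym p n := by
    intro n _
    have h := mul_le_mul_of_nonneg_left (wc_neg_one_le_legendreSym p n) (Nat.cast_nonneg (r n) :
      (0 : ℤ) ≤ r n)
    linarith
  have h4 := sum_le_sum h3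
  rw [sum_neg_distrib] at h4
  rw [← sum_filter_add_sum_filter_not (range p)
      (fun n : ℕ => (n ≠ 0 ∧ legendreSym p n = 1) ∧ r n = 1) (fun n => (r n : ℤ) * legendreSym p n),
    ← sum_filter_add_sum_filter_not (range p)
      (fun n : ℕ => (n ≠ 0 ∧ legendreSym p n = 1) ∧ r n = 1) r, h1, h2]
  push_cast
  linarith

/-! ## The double character sum over `Q × Q` -/

/-- Regrouping the pairs `a < b` by the residue of `a + b`:
`Σ_{a<b} χ_p(a+b) = Σ_{n<p} r_Q(n) χ_p(n)`. -/
theorem wc_pair_sum_fiber (p : ℕ) [Fact p.Prime] (Q : Finset ℕ) :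
    ∑ ab ∈ (Q ×ˢ Q).filter (fun ab : ℕ × ℕ => ab.1 < ab.2), legendreSym p ((ab.1 : ℤ) + ab.2) =
      ∑ n ∈ range p, (((Q ×ˢ Q).filter
          (fun ab : ℕ × ℕ => ab.1 < ab.2 ∧ (ab.1 + ab.2) % p = n)).card : ℤ) * legendreSym p n := by
  have hp : 0 < p := (Fact.out : p.Prime).pos
  have key : ∀ ab : ℕ × ℕ, legendreSym p ((ab.1 : ℤ) + ab.2) =
      legendreSym p (((ab.1 + ab.2) % p : ℕ) : ℤ) := by
    intro ab
    rw [legendreSym.mod p ((ab.1 : ℤ) + ab.2)]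
    push_cast
    rfl
  rw [sum_congr rfl fun ab _ => key ab, ← sum_fiberwise_of_maps_to'
    (s := (Q ×ˢ Q).filter (fun ab : ℕ × ℕ => ab.1 < ab.2)) (t := range p)
    (g := fun ab : ℕ × ℕ => (ab.1 + ab.2) % p) (fun ab _ => mem_range.2 (Nat.mod_lt _ hp))
    (fun n : ℕ => legendreSym p (n : ℤ))]
  refine sum_congr rfl fun n _ => ?_
  rw [sum_const, filter_filter, nsmul_eq_mul]

/-- The diagonal terms are each at least `-1`. -/
theorem wc_diag_ge (p : ℕ) [Fact p.Prime] (Q : Finset ℕ) :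
    -(Q.card : ℤ) ≤ ∑ a ∈ Q, legendreSym p ((a : ℤ) + a) := by
  calc -(Q.card : ℤ) = ∑ _a ∈ Q, (-1 : ℤ) := by simp
    _ ≤ ∑ a ∈ Q, legendreSym p ((a : ℤ) + a) :=
        sum_le_sum fun a _ => wc_neg_one_le_legendreSym p ((a : ℤ) + a)

/-- Trichotomy split of the double sum: diagonal plus twice the sum over pairs `a < b`. -/
theorem wc_double_sum_split (p : ℕ) [Fact p.Prime] (Q : Finset ℕ) :
    ∑ x ∈ Q, ∑ a ∈ Q, legendreSym p ((x : ℤ) + a) =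
      2 * ∑ ab ∈ (Q ×ˢ Q).filter (fun ab : ℕ × ℕ => ab.1 < ab.2), legendreSym p ((ab.1 : ℤ) + ab.2) +
        ∑ a ∈ Q, legendreSym p ((a : ℤ) + a) := by
  have h1 : ∑ x ∈ Q, ∑ a ∈ Q, legendreSym p ((x : ℤ) + a) =
      ∑ ab ∈ Q ×ˢ Q, legendreSym p ((ab.1 : ℤ) + ab.2) :=
    (sum_product Q Q (fun ab : ℕ × ℕ => legendreSym p ((ab.1 : ℤ) + ab.2))).symm
  have h2 : ∑ ab ∈ (Q ×ˢ Q).filter (fun ab : ℕ × ℕ => ab.1 < ab.2),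
      legendreSym p ((ab.swap.1 : ℤ) + ab.swap.2) =
        ∑ ab ∈ (Q ×ˢ Q).filter (fun ab : ℕ × ℕ => ab.1 < ab.2), legendreSym p ((ab.1 : ℤ) + ab.2) :=
    sum_congr rfl fun ab _ => by rw [Prod.fst_swap, Prod.snd_swap, add_comm]
  rw [h1, qrp_sum_product_split Q (fun ab : ℕ × ℕ => legendreSym p ((ab.1 : ℤ) + ab.2)), h2, two_mul]

/-! ## The stub -/

/-- **Stub 3 (window counting, elementary).**  For an odd prime `p` and `Q ⊆ [0,p)` with error set
`Err = {n < p : r_Q(n) ≠ 1_QR(n)}`: (coverage) `p − 1 − 2#Err ≤ #Q(#Q − 1)` — the `(p−1)/2` non-zero residues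
outside `Err` each carry exactly one pair; and (first moment on `Q`)
`2(p−1) − 4#Err − #Q² ≤ Σ_{x∈Q} Σ_{a∈Q} χ_p(x+a)` — split into the diagonal (`≥ −#Q`) and twice the sum over
pairs `a < b` of `χ_p(a+b) = Σ_n r_Q(n)χ_p(n) ≥ 2#G − C(#Q,2)`, `G` the good residues. -/
theorem stub_windowCounting :
    ∀ (p : ℕ) [Fact p.Prime], p ≠ 2 → ∀ Q : Finset ℕ, (∀ a ∈ Q, a < p) →
      ((p : ℤ) - 1 - 2 * (((range p).filter (fun n => ((Q ×ˢ Q).filter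
              (fun ab : ℕ × ℕ => ab.1 < ab.2 ∧ (ab.1 + ab.2) % p = n)).card ≠
                (if n ≠ 0 ∧ legendreSym p n = 1 then 1 else 0))).card : ℤ) ≤
          (Q.card : ℤ) * ((Q.card : ℤ) - 1)) ∧
      (2 * ((p : ℤ) - 1) - 4 * (((range p).filter (fun n => ((Q ×ˢ Q).filter
              (fun ab : ℕ × ℕ => ab.1 < ab.2 ∧ (ab.1 + ab.2) % p = n)).card ≠
                (if n ≠ 0 ∧ legendreSym p n = 1 then 1 else 0))).card : ℤ) - (Q.card : ℤ) ^ 2 ≤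
          ∑ x ∈ Q, ∑ a ∈ Q, legendreSym p ((x : ℤ) + a)) := by
  intro p _ hp2 Q _
  have hp : p.Prime := Fact.out
  have hA := wc_two_card_qr p hp2
  have hB := wc_sum_count p hp.pos Q
  have hC := wc_two_card_pairs Q
  have hD := wc_card_qr_le p
    (fun n => ((Q ×ˢ Q).filter (fun ab : ℕ × ℕ => ab.1 < ab.2 ∧ (ab.1 + ab.2) % p = n)).card)
  have hD' := wc_card_good_le_sum p
    (fun n => ((Q ×ˢ Q).filter (fun ab : ℕ × ℕ => ab.1 < ab.2 ∧ (ab.1 + ab.2) % p = n)).card)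
  have hE := wc_sum_mul_legendreSym_ge p
    (fun n => ((Q ×ˢ Q).filter (fun ab : ℕ × ℕ => ab.1 < ab.2 ∧ (ab.1 + ab.2) % p = n)).card)
  have hF := wc_pair_sum_fiber p Q
  have hG := wc_diag_ge p Q
  have hH := wc_double_sum_split p Q
  rw [hB] at hD' hE
  rw [← hF] at hE
  have hCz : 2 * (((Q ×ˢ Q).filter (fun ab : ℕ × ℕ => ab.1 < ab.2)).card : ℤ) + (Q.card : ℤ) =
      (Q.card : ℤ) * (Q.card : ℤ) := by exact_mod_cast hC
  have hDz := Nat.cast_le (α := ℤ) |>.mpr hD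
  have hD'z := Nat.cast_le (α := ℤ) |>.mpr hD'
  push_cast at hDz hD'z
  refine ⟨?_, ?_⟩
  · nlinarith [hA, hCz, hDz, hD'z]
  · rw [hH]
    nlinarith [hA, hCz, hDz, hD'z, hE, hG]

end Summit.ValiantsHypothesis.ValiantsHypothesis.Theorems.CharPSparseSOSTraceBias
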